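import Mathlib
import HarnessLib
import Literature.MathematicalPhysics.KineticTheory.HardSphereEulerProofs
import Literature.Analysis.FluidPDE.HardSphereFlowJointMeasurable
import Summits.AtomisticToContinuum.HydrodynamicLimit.Theorems.BoltzmannGreenKubo.Negative.Stationarity
import Summits.AtomisticToContinuum.HydrodynamicLimit.Theorems.AntiMazurCoboundariesShearStressHalfDrudeDisplacement
import Summits.AtomisticToContinuum.HydrodynamicLimit.Theorems.OneFlightGossipEngineKineticCurrentsWindowLDApriori
import Summits.AtomisticToContinuum.HydrodynamicLimit.Theorems.OneFlightGossipEngineEquilibriumStressVarianceDecayWindows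

/-!
# Rényi quasi-invariance of ISOTHERMAL local Gibbs laws over a kinetic window

Helper toward the registered stub `stub_windowRenyi` (line `sigma-uniform-equilibrium-transfer`,
shared with line `Sketch`) of the crux `KineticCurrentsWindowLDUniform`
(stmt-AtomisticToContinuum-14662): the Rényi form
`∫ (ψ ∘ Φ_{-r})^p ψ^{1-p} dL ≤ e^{p δ (N+1)}` of the quasi-invariance of the local Gibbs law
`λ = ψ · L` (`ψ` the canonical local Gibbs density, `L` the Liouville measure) uniformly over the
kinetic window `r ∈ [0, τ(N+1)^{-1/3}]`, for ISOTHERMAL profiles (constant drift `u₀` and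
temperature `θ₀`, ARBITRARY continuous activity `a > 0`) and EVERY order `p > 1`
(`stub_windowRenyi_isothermal`); the registered `∃ p > 1` shape is `stub_windowRenyi_isothermal'`.
This is exactly the input consumed by the landed glue `stub_windowTransfer_of_renyi`.

Proof. With constant `u₀, θ₀` the Maxwellian factor of `ψ` is conserved along good orbits
(energy and momentum, `BoltzmannGreenKuboOrthMomentum.tensorPow_localGibbsProfile_const_flow`), so
for good `z`, with `w = Φ_{-r} z` (also good, `Φ_r w = z`),
`ψ(w) = ψ(z) · exp S(z)`, `S(z) = Σᵢ (log a(xᵢ(-r)) − log a(xᵢ(0)))` (cocycle); the hard-core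
indicator and the partition function cancel and `ψ(z) > 0` on the good set, so the integrand is
`ψ(z) exp(p S(z))` almost everywhere (no `0^{1-p}` junk: `L` is carried by the domain and the
complement of the good set is `L`-null). Uniform continuity of `log a` on `𝕋³` gives
`log a x − log a y ≤ δ/2 + C dist(y,x)²`; the displacement of particle `i` over `[0,r]` (applied
at `w`) is at most `∫₀ʳ ‖vᵢ‖` (`ShearStressHalfDrudeDisplacement.euclidDist_flow_le_integral_norm_vel`),
Cauchy–Schwarz and `Σᵢ ∫₀ʳ ‖vᵢ‖² = 2E r` give `p S ≤ p δ (N+1)/2 + 2 p C r² E(z)`; the Gaussian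
energy moments of `λ` (`lintegral_exp_mul_configEnergy_localGibbsLaw_le`) are `≤ e^{pδ(N+1)/2}`
once `4 p C r² ≤ γ(pδ/2, θ₀, ‖u₀‖)`, which holds on the kinetic window for `N ≥ N₀` since
`w_N → 0`. No collision counting is needed. (The static lemmas are adapted from the landed
isothermal transfer file `…WindowTransferIsothermal.lean`, whose helpers are private.)
-/

noncomputable section

open MeasureTheory Set Filter
open scoped ENNReal Topology

namespace Summit.AtomisticToContinuum.HydrodynamicLimit.Theorems.KineticCurrentsWindowLDUniformSigmaUniform

open Literature.Analysis.FluidPDE (HardSphereFlow Config localMaxwellian canonicalDensity liouville)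
open Literature.MathematicalPhysics.KineticTheory (T3 V3 hsDiameter localGibbsLaw localGibbsMeasure
  localGibbsProfile)
open Literature.Analysis.FluidPDE Literature.MathematicalPhysics.KineticTheory

/-! ### Static helpers -/

/-- Log-increments of a continuous positive function on `𝕋³` are uniformly small up to a
quadratic penalty in the minimal-image distance: for every `κ > 0` there is `C ≥ 0` with
`log a x − log a y ≤ κ + C · dist_{𝕋³}(y, x)²`. [folklore] -/
-- adapted from OneFlightGossipEngineKineticCurrentsWindowLDUniformWindowTransferIsothermal.lean
private theorem log_sub_log_le_quad {a : T3 → ℝ} (ha : Continuous a) (ha0 : ∀ x, 0 < a x)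
    {κ : ℝ} (hκ : 0 < κ) :
    ∃ C : ℝ, 0 ≤ C ∧ ∀ x y : T3,
      Real.log (a x) - Real.log (a y) ≤ κ + C * Torus.euclidDist y x ^ 2 := by
  have hg : Continuous fun x => Real.log (a x) := ha.log fun x => (ha0 x).ne'
  obtain ⟨B, hB0, hB⟩ := exists_forall_abs_le_of_continuous hg
  obtain ⟨ℓ, hℓ, huc⟩ := Metric.uniformContinuous_iff.1
    (CompactSpace.uniformContinuous_of_continuous hg) κ hκ
  refine ⟨2 * B / ℓ ^ 2, by positivity, fun x y => ?_⟩
  have hnn : 0 ≤ 2 * B / ℓ ^ 2 * Torus.euclidDist y x ^ 2 := by positivity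
  by_cases hd : Torus.euclidDist y x < ℓ
  · have hxy : dist x y < ℓ := by
      rw [dist_eq_norm]
      exact (Torus.norm_sub_le_euclidDist_holds x y).trans_lt (by rwa [Torus.euclidDist_comm])
    have h := huc hxy
    rw [Real.dist_eq] at h
    linarith [(le_abs_self _).trans_lt h]
  · rw [not_lt] at hd
    have h1 : Real.log (a x) - Real.log (a y) ≤ 2 * B := by
      linarith [(abs_le.1 (hB x)).2, (abs_le.1 (hB y)).1]
    have h2 : 2 * B ≤ 2 * B / ℓ ^ 2 * Torus.euclidDist y x ^ 2 := by
      rw [div_mul_eq_mul_div, le_div_iff₀ (by positivity)]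
      exact mul_le_mul_of_nonneg_left (pow_le_pow_left₀ hℓ.le hd 2) (by positivity)
    linarith

/-- **Activity log-ratio along a good orbit is controlled by the conserved energy.** If
`g x − g y ≤ κ + C dist(y,x)²`, then over a window `[0, r]`,
`Σᵢ (g(xᵢ(0)) − g(xᵢ(r))) ≤ n κ + C · 2 r² E(z)` (displacement `≤ ∫₀ʳ ‖vᵢ‖`, Cauchy–Schwarz,
`Σᵢ ∫₀ʳ ‖vᵢ‖² = 2 E(z) r`). [folklore] -/
-- adapted from OneFlightGossipEngineKineticCurrentsWindowLDUniformWindowTransferIsothermal.lean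
private theorem sum_log_ratio_le {ε : ℝ} {n : ℕ}
    (Φ : HardSphereFlow (Torus.geometry (Fin 3)) ε n) {z : Config n (Fin 3) T3} (hz : z ∈ Φ.good)
    {g : T3 → ℝ} {κ C : ℝ} (hC : 0 ≤ C)
    (hg : ∀ x y : T3, g x - g y ≤ κ + C * Torus.euclidDist y x ^ 2) {r : ℝ} (hr : 0 ≤ r) :
    ∑ i, (g (z i).1 - g (Φ.flow r z i).1) ≤ n * κ + C * (2 * r ^ 2 * configEnergy z) := by
  obtain ⟨hint2, hsum⟩ := sum_window_integral_norm_sq_eq Φ hz r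
  have hγm : Measurable fun t => Φ.flow t z := (Φ.isTrajectory z hz).measurable_torus
  have hint1 : ∀ i, IntervalIntegrable (fun s => ‖(Φ.flow s z i).2‖) volume 0 r := fun i =>
    (intervalIntegrable_const (c := Real.sqrt (2 * configEnergy z))).mono_fun'
      ((measurable_pi_apply i).comp hγm).snd.norm.aestronglyMeasurable
      (ae_of_all _ fun s => by simpa only [norm_norm] using Φ.norm_vel_flow_le hz s i)
  have hdi : ∀ i, Torus.euclidDist (Φ.flow r z i).1 (z i).1 ^ 2 ≤
      r * ∫ s in (0 : ℝ)..r, ‖(Φ.flow s z i).2‖ ^ 2 := fun i =>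
    (pow_le_pow_left₀ (norm_nonneg _)
      (ShearStressHalfDrudeDisplacement.euclidDist_flow_le_integral_norm_vel Φ hz i hr) 2).trans
      (EquilibriumStressVarianceDecayC3.sq_integral_le_mul_integral_sq hr (hint1 i) (hint2 i))
  calc ∑ i, (g (z i).1 - g (Φ.flow r z i).1)
      ≤ ∑ i, (κ + C * (r * ∫ s in (0 : ℝ)..r, ‖(Φ.flow s z i).2‖ ^ 2)) :=
        Finset.sum_le_sum fun i _ =>
          (hg _ _).trans (add_le_add le_rfl (mul_le_mul_of_nonneg_left (hdi i) hC))
    _ = n * κ + C * (2 * r ^ 2 * configEnergy z) := by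
        rw [Finset.sum_add_distrib, Finset.sum_const, Finset.card_univ, Fintype.card_fin,
          nsmul_eq_mul, ← Finset.mul_sum, ← Finset.mul_sum, hsum]
        ring

/-- The activity factors out of the tensor power of a local Gibbs profile:
`∏ᵢ a(xᵢ) M(vᵢ) = exp(Σᵢ log a(xᵢ)) · ∏ᵢ M(vᵢ)` for `a > 0`. [folklore] -/
-- adapted from OneFlightGossipEngineKineticCurrentsWindowLDUniformWindowTransferIsothermal.lean
private theorem tensorPow_localGibbsProfile_eq_exp_mul {a : T3 → ℝ} (ha0 : ∀ x, 0 < a x)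
    (u : T3 → V3) (θ : T3 → ℝ) {n : ℕ} (z : Config n (Fin 3) T3) :
    tensorPow n (localGibbsProfile a u θ) z =
      Real.exp (∑ i, Real.log (a (z i).1)) * tensorPow n (localGibbsProfile (fun _ => 1) u θ) z := by
  simp only [tensorPow, localGibbsProfile, one_mul]
  rw [Real.exp_sum, ← Finset.prod_mul_distrib]
  exact Finset.prod_congr rfl fun i _ => by rw [Real.exp_log (ha0 _)]

/-- **Cocycle of the isothermal local Gibbs density along a good orbit.** With constant drift and
temperature the Maxwellian factor is conserved (energy and momentum), so
`ψ(z) = ψ(Φ_t z) · exp Σᵢ (log a(xᵢ(0)) − log a(xᵢ(t)))`. [folklore] -/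
-- adapted from OneFlightGossipEngineKineticCurrentsWindowLDUniformWindowTransferIsothermal.lean
private theorem canonicalDensity_isothermal_cocycle {σ : ℝ} {a : T3 → ℝ} (ha0 : ∀ x, 0 < a x)
    (θ : ℝ) (u : V3) {N : ℕ}
    (Φ : HardSphereFlow (Torus.geometry (Fin 3)) (hsDiameter σ N) (N + 1))
    {z : Config (N + 1) (Fin 3) T3} (hz : z ∈ Φ.good) (t : ℝ) :
    canonicalDensity (Torus.geometry (Fin 3)) (hsDiameter σ N) (N + 1)
        (localGibbsProfile a (fun _ => u) (fun _ => θ)) z =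
      canonicalDensity (Torus.geometry (Fin 3)) (hsDiameter σ N) (N + 1)
          (localGibbsProfile a (fun _ => u) (fun _ => θ)) (Φ.flow t z) *
        Real.exp (∑ i, (Real.log (a (z i).1) - Real.log (a (Φ.flow t z i).1))) := by
  simp only [canonicalDensity]
  rw [indicator_of_mem (Φ.good_subset hz), indicator_of_mem (Φ.good_subset (Φ.mapsTo_good t hz)),
    tensorPow_localGibbsProfile_eq_exp_mul ha0, tensorPow_localGibbsProfile_eq_exp_mul ha0,
    BoltzmannGreenKuboOrthMomentum.tensorPow_localGibbsProfile_const_flow 1 θ u Φ hz t,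
    Finset.sum_sub_distrib, Real.exp_sub, mul_div_assoc', eq_div_iff (Real.exp_pos _).ne']
  ring

/-- The canonical density of an isothermal local Gibbs profile is positive on the good set
(`a > 0`, `θ₀ > 0`, `σ ≤ 1/2`: the partition function is positive). [folklore] -/
private theorem canonicalDensity_pos_of_good {σ : ℝ} {a : T3 → ℝ} (ha : Continuous a)
    (ha0 : ∀ x, 0 < a x) {θ : ℝ} (hθ : 0 < θ) (u : V3) (hσ2 : σ ≤ 1 / 2) {N : ℕ}
    (Φ : HardSphereFlow (Torus.geometry (Fin 3)) (hsDiameter σ N) (N + 1))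
    {z : Config (N + 1) (Fin 3) T3} (hz : z ∈ Φ.good) :
    0 < canonicalDensity (Torus.geometry (Fin 3)) (hsDiameter σ N) (N + 1)
      (localGibbsProfile a (fun _ => u) (fun _ => θ)) z := by
  unfold canonicalDensity
  rw [Set.indicator_of_mem (Φ.good_subset hz), canonicalPartition_eq_posPartition ha
    continuous_const continuous_const (fun x => (ha0 x).le) (fun _ => hθ)]
  refine mul_pos (inv_pos.2 (posPartition_pos ha ha0 hσ2 N)) ?_
  exact Finset.prod_pos fun i _ => mul_pos (ha0 _) (localMaxwellian_pos one_pos hθ _ _)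

/-- Choice of the energy exponent: for `δ > 0` there is `γ > 0` with `2γθ₀ < 1` and
`exp(γU²) (1 − 2γθ₀)^{-3/2} ≤ exp δ` (`(1 − x)⁻¹ ≤ e^{2x}` on `[0, 1/2]`). [folklore] -/
-- adapted from OneFlightGossipEngineKineticCurrentsWindowLDUniformWindowTransferIsothermal.lean
private theorem exists_gamma {θ₀ δ : ℝ} (hθ : 0 < θ₀) (hδ : 0 < δ) (U : ℝ) :
    ∃ γ : ℝ, 0 < γ ∧ 2 * γ * θ₀ < 1 ∧
      Real.exp (γ * U ^ 2) * (1 - 2 * γ * θ₀) ^ (-(3 : ℝ) / 2) ≤ Real.exp δ := by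
  obtain ⟨γ, hγ0, hγ1, hγ2⟩ : ∃ γ : ℝ, 0 < γ ∧ γ * (4 * θ₀) ≤ 1 ∧ γ * (U ^ 2 + 6 * θ₀) ≤ δ :=
    ⟨min (1 / (4 * θ₀)) (δ / (U ^ 2 + 6 * θ₀)), lt_min (by positivity) (by positivity),
      (le_div_iff₀ (by positivity)).1 (min_le_left _ _),
      (le_div_iff₀ (by positivity)).1 (min_le_right _ _)⟩
  have hx0 : 0 ≤ 2 * γ * θ₀ := by positivity
  have hx2 : 2 * γ * θ₀ ≤ 1 / 2 := by linarith
  have hk : 0 < 1 - 2 * γ * θ₀ := by linarith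
  have h1 : (1 - 2 * γ * θ₀)⁻¹ ≤ Real.exp (2 * (2 * γ * θ₀)) := by
    rw [inv_le_iff_one_le_mul₀' hk]
    nlinarith [mul_nonneg hk.le (sub_nonneg.2 (Real.add_one_le_exp (2 * (2 * γ * θ₀)))),
      mul_nonneg hx0 (sub_nonneg.2 hx2)]
  refine ⟨γ, hγ0, by linarith, ?_⟩
  calc Real.exp (γ * U ^ 2) * (1 - 2 * γ * θ₀) ^ (-(3 : ℝ) / 2)
      ≤ Real.exp (γ * U ^ 2) * Real.exp (2 * (2 * γ * θ₀)) ^ ((3 : ℝ) / 2) := by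
        rw [show (-(3 : ℝ) / 2) = -((3 : ℝ) / 2) by ring, Real.rpow_neg hk.le,
          ← Real.inv_rpow hk.le]
        exact mul_le_mul_of_nonneg_left
          (Real.rpow_le_rpow (inv_nonneg.2 hk.le) h1 (by norm_num)) (Real.exp_nonneg _)
    _ = Real.exp (γ * (U ^ 2 + 6 * θ₀)) := by
        rw [← Real.exp_mul, ← Real.exp_add]
        congr 1
        ring
    _ ≤ Real.exp δ := Real.exp_le_exp.2 hγ2

/-- The kinetic window `w_N = τ (N+1)^{-1/3}` tends to `0`, so `C · 4 w_N² < γ` eventually.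
[folklore] -/
-- adapted from OneFlightGossipEngineKineticCurrentsWindowLDUniformWindowTransferIsothermal.lean
private theorem exists_N0 (τ C : ℝ) {γ : ℝ} (hγ : 0 < γ) :
    ∃ N₀ : ℕ, ∀ N : ℕ, N₀ ≤ N → C * (4 * (τ * ((N : ℝ) + 1) ^ (-(1 / 3 : ℝ))) ^ 2) < γ := by
  have h1 : Tendsto (fun N : ℕ => τ * ((N : ℝ) + 1) ^ (-(1 / 3 : ℝ))) atTop (𝓝 (τ * 0)) :=
    ((tendsto_rpow_neg_atTop (by norm_num : (0 : ℝ) < 1 / 3)).comp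
      (tendsto_atTop_add_const_right atTop 1 tendsto_natCast_atTop_atTop)).const_mul τ
  have h2 : Tendsto (fun N : ℕ => C * (4 * (τ * ((N : ℝ) + 1) ^ (-(1 / 3 : ℝ))) ^ 2)) atTop
      (𝓝 (C * (4 * (τ * 0) ^ 2))) := ((h1.pow 2).const_mul 4).const_mul C
  rw [mul_zero, zero_pow two_ne_zero, mul_zero, mul_zero] at h2
  exact eventually_atTop.1 (h2.eventually (gt_mem_nhds hγ))

/-! ### The helper theorem -/

/-- **Rényi quasi-invariance of isothermal local Gibbs laws over a kinetic window (every order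
`p > 1`).** For a continuous activity `a > 0`, constant temperature `θ₀ > 0` and drift `u₀`,
`0 < σ ≤ 1/2`, every `p > 1`, `τ, δ > 0` and every flow family there is `N₀` such that for
`N ≥ N₀` and every `r` in the kinetic window `[0, τ(N+1)^{-1/3}]`,
`∫ (ψ ∘ Φ_{-r})^p ψ^{1-p} dL ≤ e^{p δ (N+1)}` (`ψ` the canonical local Gibbs density, `L` the
Liouville measure): the Maxwellian factor of `ψ` is conserved, the activity factor changes by the
displacement cocycle, which is controlled by the conserved energy over a vanishing window, and the
Gaussian energy moments of the local Gibbs law are geometric in `N`. [folklore] -/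
theorem stub_windowRenyi_isothermal :
    ∀ (a : T3 → ℝ) (θ₀ : ℝ) (u₀ : V3), Continuous a → (∀ x, 0 < a x) → 0 < θ₀ →
    ∀ σ : ℝ, 0 < σ → σ ≤ 1 / 2 →
    ∀ p : ℝ, 1 < p → ∀ τ : ℝ, 0 < τ → ∀ δ : ℝ, 0 < δ →
    ∀ Φ : (N : ℕ) →
      HardSphereFlow (Literature.Analysis.FluidPDE.Torus.geometry (Fin 3)) (hsDiameter σ N) (N + 1),
    ∃ N₀ : ℕ, ∀ N : ℕ, N₀ ≤ N → ∀ r ∈ Set.Icc (0 : ℝ) (τ * ((N : ℝ) + 1) ^ (-(1 / 3 : ℝ))),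
      ∫⁻ z, ENNReal.ofReal (canonicalDensity (Literature.Analysis.FluidPDE.Torus.geometry (Fin 3))
            (hsDiameter σ N) (N + 1) (localGibbsProfile a (fun _ => u₀) (fun _ => θ₀))
            ((Φ N).flow (-r) z)) ^ p *
          ENNReal.ofReal (canonicalDensity (Literature.Analysis.FluidPDE.Torus.geometry (Fin 3))
            (hsDiameter σ N) (N + 1) (localGibbsProfile a (fun _ => u₀) (fun _ => θ₀)) z) ^ (1 - p)
        ∂(liouville (Literature.Analysis.FluidPDE.Torus.geometry (Fin 3)) (N + 1) (hsDiameter σ N)) ≤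
      ENNReal.ofReal (Real.exp (p * (δ * ((N : ℝ) + 1)))) := by
  intro a θ₀ u₀ ha ha0 hθ σ _hσ hσ2 p hp τ _hτ δ hδ Φ
  have hp0 : 0 < p := one_pos.trans hp
  -- static constants: the log-oscillation bound, the energy exponent `γ`, and `N₀`
  obtain ⟨C, hC0, hC⟩ := log_sub_log_le_quad ha ha0 (half_pos hδ)
  have hδ' : 0 < p * δ / 2 := by positivity
  obtain ⟨γ, hγ0, hγθ, hK⟩ := exists_gamma hθ hδ' ‖u₀‖
  obtain ⟨N₀, hN₀⟩ := exists_N0 τ (p * C) hγ0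
  refine ⟨N₀, fun N hN r hr => ?_⟩
  -- the Liouville measure, the density `ψ`, the Gaussian weight `Q`
  set cN : ℝ≥0∞ := ENNReal.ofReal (Real.exp (p * δ / 2 * ((N : ℝ) + 1))) with hcN
  set L := liouville (Torus.geometry (Fin 3)) (N + 1) (hsDiameter σ N) with hL
  set ψ : Config (N + 1) (Fin 3) T3 → ℝ≥0∞ := fun z => ENNReal.ofReal
    (canonicalDensity (Torus.geometry (Fin 3)) (hsDiameter σ N) (N + 1)
      (localGibbsProfile a (fun _ => u₀) (fun _ => θ₀)) z) with hψ
  have hlaw : localGibbsLaw σ a (fun _ => u₀) (fun _ => θ₀) N (Φ N) = L.withDensity ψ := by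
    simp only [localGibbsLaw, particleLaw_eq, hL, hψ]
  have hψm : Measurable ψ :=
    (measurable_canonicalDensity (hsDiameter σ N) (N + 1)
      (measurable_localGibbsProfile ha continuous_const continuous_const)).ennreal_ofReal
  have hEm : Measurable fun z : Config (N + 1) (Fin 3) T3 => configEnergy z := by
    unfold configEnergy
    exact measurable_const.mul (Finset.measurable_sum _ fun i _ =>
      ((measurable_pi_apply i).snd.norm.pow_const 2))
  set Q : Config (N + 1) (Fin 3) T3 → ℝ≥0∞ := fun w =>
    ENNReal.ofReal (Real.exp (γ * configEnergy w)) with hQ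
  have hQm : Measurable Q := (Real.measurable_exp.comp (hEm.const_mul γ)).ennreal_ofReal
  have hψQm : Measurable fun w => ψ w * Q w := hψm.mul hQm
  -- Step 1: cocycle, cancellation of `ψ^{p} ψ^{1-p}` on the good set, energy bound of the cocycle
  have hpt : ∀ᵐ z ∂L, ψ ((Φ N).flow (-r) z) ^ p * ψ z ^ (1 - p) ≤ ψ z * (cN * Q z) := by
    filter_upwards [(Φ N).ae_mem_good] with z hz
    have hw : (Φ N).flow (-r) z ∈ (Φ N).good := (Φ N).mapsTo_good (-r) hz
    have hzw : (Φ N).flow r ((Φ N).flow (-r) z) = z := by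
      have h := (Φ N).flow_neg_flow (-r) hz
      rwa [neg_neg] at h
    have hcoc := canonicalDensity_isothermal_cocycle ha0 θ₀ u₀ (Φ N) hw r
    have hSz := sum_log_ratio_le (Φ N) hw hC0 hC hr.1
    rw [hzw] at hcoc hSz
    rw [(Φ N).configEnergy_flow hz (-r)] at hSz
    push_cast at hSz
    have hA := canonicalDensity_pos_of_good ha ha0 hθ u₀ hσ2 (Φ N) hz
    have hA0 : ψ z ≠ 0 := (ENNReal.ofReal_pos.2 hA).ne'
    simp only [hψ, hQ, hcN] at hA0 ⊢
    rw [hcoc, ENNReal.ofReal_mul hA.le, ENNReal.mul_rpow_of_nonneg _ _ hp0.le, mul_right_comm,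
      ← ENNReal.rpow_add _ _ hA0 ENNReal.ofReal_ne_top, show p + (1 - p) = 1 by ring,
      ENNReal.rpow_one, ENNReal.ofReal_rpow_of_nonneg (Real.exp_nonneg _) hp0.le, ← Real.exp_mul,
      ← ENNReal.ofReal_mul (Real.exp_nonneg _), ← Real.exp_add]
    refine mul_le_mul_right (ENNReal.ofReal_le_ofReal (Real.exp_le_exp.2 ?_)) _
    have hE0 : 0 ≤ configEnergy z := by unfold configEnergy; positivity
    have hcr : p * C * (4 * r ^ 2) ≤ γ :=
      (mul_le_mul_of_nonneg_left (mul_le_mul_of_nonneg_left (pow_le_pow_left₀ hr.1 hr.2 2)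
        (by norm_num)) (by positivity)).trans (hN₀ N hN).le
    have h1 := mul_le_mul_of_nonneg_left hSz hp0.le
    have h2 := mul_le_mul_of_nonneg_right hcr hE0
    have h3 : 0 ≤ p * C * r ^ 2 * configEnergy z := by positivity
    nlinarith [h1, h2, h3]
  -- Step 2: the Gaussian energy moment of the local Gibbs law
  have hK0 : 0 ≤ Real.exp (γ * ‖u₀‖ ^ 2) * (1 - 2 * γ * θ₀) ^ (-(3 : ℝ) / 2) :=
    mul_nonneg (Real.exp_nonneg _) (Real.rpow_nonneg (by linarith) _)
  have hKN : (Real.exp (γ * ‖u₀‖ ^ 2) * (1 - 2 * γ * θ₀) ^ (-(3 : ℝ) / 2)) ^ (N + 1) ≤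
      Real.exp (p * δ / 2 * ((N : ℝ) + 1)) := by
    refine (pow_le_pow_left₀ hK0 hK (N + 1)).trans_eq ?_
    rw [← Real.exp_nat_mul]
    congr 1
    push_cast
    ring
  calc ∫⁻ z, ψ ((Φ N).flow (-r) z) ^ p * ψ z ^ (1 - p) ∂L
      ≤ ∫⁻ z, ψ z * (cN * Q z) ∂L := lintegral_mono_ae hpt
    _ = cN * ∫⁻ w, Q w ∂(localGibbsLaw σ a (fun _ => u₀) (fun _ => θ₀) N (Φ N)) := by
        rw [hlaw, lintegral_withDensity_eq_lintegral_mul L hψm hQm]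
        simp only [Pi.mul_apply]
        rw [← lintegral_const_mul cN hψQm]
        exact lintegral_congr fun w => by ring
    _ ≤ cN * ENNReal.ofReal
          ((Real.exp (γ * ‖u₀‖ ^ 2) * (1 - 2 * γ * θ₀) ^ (-(3 : ℝ) / 2)) ^ (N + 1)) :=
        mul_le_mul_right (lintegral_exp_mul_configEnergy_localGibbsLaw_le ha continuous_const
          continuous_const ha0 (fun _ => hθ) hσ2 N (Φ N) (Θ := θ₀) (U := ‖u₀‖) hγ0.le
          (fun _ => le_rfl) (fun _ => le_rfl) hγθ) _
    _ ≤ cN * cN := mul_le_mul_right (ENNReal.ofReal_le_ofReal hKN) _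
    _ = ENNReal.ofReal (Real.exp (p * (δ * ((N : ℝ) + 1)))) := by
        rw [hcN, ← ENNReal.ofReal_mul (Real.exp_nonneg _), ← Real.exp_add]
        congr 2
        ring

/-- **Rényi quasi-invariance of isothermal local Gibbs laws, registered shape.** The `∃ p > 1`
form of `stub_windowRenyi_isothermal` (take `p = 2`): exactly the registered signature of
`stub_windowRenyi` specialised to constant drift and temperature, ready for the landed glue
`stub_windowTransfer_of_renyi`. [folklore] -/
theorem stub_windowRenyi_isothermal' :
    ∀ (a : T3 → ℝ) (θ₀ : ℝ) (u₀ : V3), Continuous a → (∀ x, 0 < a x) → 0 < θ₀ →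
    ∀ σ : ℝ, 0 < σ → σ ≤ 1 / 2 →
    ∃ p : ℝ, 1 < p ∧ ∀ τ : ℝ, 0 < τ → ∀ δ : ℝ, 0 < δ →
    ∀ Φ : (N : ℕ) →
      HardSphereFlow (Literature.Analysis.FluidPDE.Torus.geometry (Fin 3)) (hsDiameter σ N) (N + 1),
    ∃ N₀ : ℕ, ∀ N : ℕ, N₀ ≤ N → ∀ r ∈ Set.Icc (0 : ℝ) (τ * ((N : ℝ) + 1) ^ (-(1 / 3 : ℝ))),
      ∫⁻ z, ENNReal.ofReal (canonicalDensity (Literature.Analysis.FluidPDE.Torus.geometry (Fin 3))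
            (hsDiameter σ N) (N + 1) (localGibbsProfile a (fun _ => u₀) (fun _ => θ₀))
            ((Φ N).flow (-r) z)) ^ p *
          ENNReal.ofReal (canonicalDensity (Literature.Analysis.FluidPDE.Torus.geometry (Fin 3))
            (hsDiameter σ N) (N + 1) (localGibbsProfile a (fun _ => u₀) (fun _ => θ₀)) z) ^ (1 - p)
        ∂(liouville (Literature.Analysis.FluidPDE.Torus.geometry (Fin 3)) (N + 1) (hsDiameter σ N)) ≤
      ENNReal.ofReal (Real.exp (p * (δ * ((N : ℝ) + 1)))) :=
  fun a θ₀ u₀ ha ha0 hθ σ hσ hσ2 =>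
    ⟨2, one_lt_two, stub_windowRenyi_isothermal a θ₀ u₀ ha ha0 hθ σ hσ hσ2 2 one_lt_two⟩

end Summit.AtomisticToContinuum.HydrodynamicLimit.Theorems.KineticCurrentsWindowLDUniformSigmaUniform

end
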